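/-
Copyright (c) 2026 the pub-hodgecm-mathlib formalisation cell (harness21).  Prover seats hodgecm-mathlib-K2Liu-p09 (g5, g6) (★ B7 ∕ ★ B8-CM, at `½`), hodgecm-mathlib-K2Liu-p27
(g0) (this all-`s₀` re-run): Track B «K2-LIT», hLiu418 = stmt-HodgeConjecture-24832; LEAD F0P6-plan (g14) EMIT #1 2026-09-04T14:48:16Z, G6-fin (F2) ALL-`s₀` EDITION, file 4.
-/
import Summits.HodgeConjecture.HodgeConjecture.Theorems.K2LiuA7NormalisedRegularityNonsplitAllS0   -- ★ file 2 (one place above `v`, all `s₀`)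
import Summits.HodgeConjecture.HodgeConjecture.Theorems.K2LiuA7NormalisedRegularitySplitAllS0      -- ★ file 3 (two places above `v`, all `s₀`)
import Summits.HodgeConjecture.HodgeConjecture.Theorems.K2LiuA7NormalisedRegularityCM            -- ★ B8-CM `exists_adaptedFrame` (+ the CM datum's Literature imports)
import HarnessLib

/-!
# Crux `HLiu418`, road `K2_Liu`, organ A7-reg (GK cocycle road), G6-fin (F2) ALL-`s₀` EDITION, file 4 (every finite place; the CM datum):
# THE NORMALISED SIEGEL INTERTWINING OPERATOR HAS NO POLE ON `0 < re s` — `∀ s₀, 0 < re s₀ → ∀ h, IsQRationalRegularAt q_v s₀ (Fn · h)`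

Cell `hodgecm-mathlib`, crux item hLiu418 = `stmt-HodgeConjecture-24832`; squad K2 ∕ K2Liu; prover K2Liu-p27 (g0).  THEOREMS ONLY; lane
`--supports stmt-HodgeConjecture-24832` (count-neutral helper).  The all-`s₀` twins of ★ B7 `K2LiuA7NormalisedRegularity.normalisedRegularity` (every finite place `v` of `F`:
one place of `E` above `v` ★ file 2 `normalisedRegularity_of_forall_eq_allS0`, two places ★ file 3 `normalisedRegularity_of_pair_allS0`, over ★ B7-R (R1) `placesOver_cases'`)
and of ★ B8-CM `K2LiuA7NormalisedRegularityCM.normalisedRegularity_cm` (the CM datum `F = L⁺`, `E = L`, `c` = complex conjugation, `δ = imagUnit L`, `T₂ = gramR L e dV dW`,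
`J = hermD`, frame by ★ B8-CM `exists_adaptedFrame`): SAME binders, SAME identity `M_v(s)(f s) h = aNorm 2 χ_v (νN(N_Δ ∩ K₀)) s · Fn s h` on `1 < re s`, and the regularity
clause **`∀ s₀ : ℂ, 0 < s₀.re → ∀ h, IsQRationalRegularAt q_v s₀ (fun s => Fn s h)`** instead of «at `½`» — the input of #41's G6-fin («the normalised local operators
contribute NO poles on `0 < re s`», consumer sheet `CENSUS-41-Phi9-ConsumerSheet` G6-fin; K2Liu-p09 (g7) σ21 2026-09-04T14:30:41Z).
HONEST LABEL.  `HC_CM` is proved only modulo the 7 printed citations (2 remaining named inputs: hLiu418 = `stmt-HodgeConjecture-24832`,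
h413 = `stmt-HodgeConjecture-24833`) until rung 0 closes.

## References
* [KudlaSweet1997] S. Kudla, W. J. Sweet, *Degenerate principal series representations for U(n,n)*, Israel J. Math. 98 (1997), §1.
* [HarrisKudlaSweet1996] M. Harris, S. Kudla, W. J. Sweet, J. AMS 9 (1996), §6 (6.14)–(6.16) (the normalising factor `a_v(s)`).
* [Casselman1980] W. Casselman, *The unramified principal series of p-adic groups I*, Compositio Math. 40 (1980), §3 Thm. 3.1 (rank-one operators, cocycle).
* [CasselsFrohlichANT1967] J. W. S. Cassels, A. Fröhlich (eds.), *Algebraic Number Theory* (1967), Ch. VII Prop. 1.2 (ii) (places of a quadratic extension).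
* [GelbartRogawski1991] S. Gelbart, J. Rogawski, *L-functions and Fourier–Jacobi coefficients for the unitary group U(3)*, Invent. Math. 105 (1991), §3.1 Prop. 3.1.1
  (the CM doubled datum `T = gramR`, `J = hermD`).
-/

set_option autoImplicit false
set_option linter.dupNamespace false -- the mandated namespace repeats `HodgeConjecture.HodgeConjecture`

noncomputable section

open scoped Classical NNReal ENNReal
open NumberField IsDedekindDomain Matrix MeasureTheory Topology
open Literature.NumberTheory.GaloisRepresentations.IsNonarchimedeanLocalField
open Literature.NumberTheory.Automorphic Literature.NumberTheory.Automorphic.UnitaryGroup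
open Literature.NumberTheory.GelbartRogawski1991.AdaptedBlocks
open Literature.NumberTheory.GelbartRogawski1991.UnitaryDualPair.LocalSplitting
open Literature.NumberTheory.GelbartRogawski1991
open Literature.NumberTheory.K2Lit.LocalSiegelDoubled
open Summit.HodgeConjecture.HodgeConjecture.Cruxes.HLiu418.K2LiuQRationalDefs
open Summit.HodgeConjecture.HodgeConjecture.Cruxes.HLiu418.K2LiuLocalLFactorDefs
open Summit.HodgeConjecture.HodgeConjecture.Cruxes.HLiu418.K2LiuLocalSiegelIwasawaFrame
open Summit.HodgeConjecture.HodgeConjecture.Cruxes.HLiu418.K2LiuLocalSiegelIwasawa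
open Summit.HodgeConjecture.HodgeConjecture.Cruxes.HLiu418.K2LiuDoubledUTwoTwoFrameTransport
open Summit.HodgeConjecture.HodgeConjecture.Cruxes.HLiu418.K2LiuDoubledUTwoTwoUnipotentHaar
open Summit.HodgeConjecture.HodgeConjecture.Cruxes.HLiu418.K2LiuLocalRingPlaceDecomposition
open Summit.HodgeConjecture.HodgeConjecture.Cruxes.HLiu418.K2LiuA7NormalisedRegularityNonsplitAllS0
open Summit.HodgeConjecture.HodgeConjecture.Cruxes.HLiu418.K2LiuA7NormalisedRegularitySplitAllS0
open Summit.HodgeConjecture.HodgeConjecture.Cruxes.HLiu418.K2LiuA7NormalisedRegularityCM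

namespace Summit.HodgeConjecture.HodgeConjecture.Cruxes.HLiu418.K2LiuA7NormalisedRegularityCMAllS0

/-! ## §1 Every finite place (one or two places of `E` above `v`) -/

section EveryPlace

variable (F : Type) [Field F] [NumberField F] (E : Type) [Field E] [NumberField E] [Algebra F E]
  [Algebra.IsQuadraticExtension F E] (c : E ≃ₐ[F] E)
  {δ : E} (hcδ : c δ = -δ) (hδ : δ ≠ 0) {d : F} (hd : δ * δ = algebraMap F E d) (v : HeightOneSpectrum (𝓞 F))
  {T₂ : Matrix (Fin 2) (Fin 2) F} (hT₂ : T₂.IsSymm) {J₂D : Matrix (Fin (2 + 2)) (Fin (2 + 2)) E} (hJ₂D : J₂D = (gramD F 2 T₂).map (algebraMap F E))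
  (D Dinv : Matrix (Fin 2) (Fin 2) F) (hDD : D * Dinv = 1) (hDD' : Dinv * D = 1) (Q : GL (Fin (2 + 2)) F)
  (hQm : (Q : Matrix (Fin (2 + 2)) (Fin (2 + 2)) F) = Matrix.reindex (e₂ 2) (e₂ 2) (Matrix.fromBlocks 1 D 1 (-D)))
  (hQ : (Q : Matrix (Fin (2 + 2)) (Fin (2 + 2)) F)ᵀ * gramD F 2 T₂ * (Q : Matrix (Fin (2 + 2)) (Fin (2 + 2)) F) = (StdForm.antidiagonal (2 + 2)).over F)

include hcδ hδ hd hT₂ hDD hDD' hQm hQ in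
/-- **(A4′-R) AT EVERY FINITE PLACE, ALL `s₀` — THE NORMALISED SIEGEL INTERTWINING OPERATOR HAS NO POLE ON `0 < re s`.**  For `χ_v` unitary, a compact open
subgroup `K₀ ≤ H_v` with the Iwasawa property `H_v = P_Δ(F_v)·K₀`, and a family `f` of smooth Siegel sections of `I_v(s, χ_v)` whose restriction to `K₀` does not depend
on `s`, there is `Fn : ℂ → H_v → ℂ` with every `s ↦ Fn s h` rational in `q_v^{-s}` and regular at EVERY `s₀` with `0 < re s₀`, such that
`M_v(s)(f s) h = aNorm 2 χ_v (νN(N_Δ ∩ K₀)) s · Fn s h` for `1 < re s` (one place of `E` above `v`: ★ file 2; two places: ★ file 3; ★ B7-R (R1)) — the all-`s₀` twin of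
★ B7 `normalisedRegularity`. [cite: KudlaSweet1997, §1] [cite: HarrisKudlaSweet1996, §6 (6.14)–(6.16)]
[cite: Casselman1980, §3 Thm. 3.1] [cite: CasselsFrohlichANT1967, Ch. VII Prop. 1.2 (ii)] -/
theorem normalisedRegularity_allS0
    [MeasurableSpace (unipDeltaLocal F E c v 2 (JD := J₂D))] [BorelSpace (unipDeltaLocal F E c v 2 (JD := J₂D))]
    (νN : Measure (unipDeltaLocal F E c v 2 (JD := J₂D))) [νN.IsHaarMeasure]
    (χv : ∀ w : PlacesOver E v, (w.1.adicCompletion E)ˣ →* ℂˣ) (hχ : ∀ (w' : PlacesOver E v) (x : (w'.1.adicCompletion E)ˣ), ‖((χv w' x : ℂˣ) : ℂ)‖ = 1)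
    (K₀ : Subgroup (UnitaryGroup.localPi E c (2 + 2) J₂D v))
    (hK₀ : IsCompact (K₀ : Set (UnitaryGroup.localPi E c (2 + 2) J₂D v)) ∧ IsOpen (K₀ : Set (UnitaryGroup.localPi E c (2 + 2) J₂D v)))
    (hIw : ∀ g : UnitaryGroup.localPi E c (2 + 2) J₂D v, ∃ p, IsSiegelDelta F E c hcδ hδ hd v 2 hT₂ hJ₂D p ∧ ∃ k ∈ K₀, g = p * k)
    (f : ℂ → UnitaryGroup.localPi E c (2 + 2) J₂D v → ℂ) (hSieg : ∀ s, IsLocalSiegelSection F E c hcδ hδ hd v 2 hT₂ hJ₂D χv s (f s)) (hsm : ∀ s, IsSmooth F E c v 2 (f s))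
    (hflat : ∀ s s' : ℂ, ∀ k ∈ K₀, f s k = f s' k) :
    ∃ Fn : ℂ → UnitaryGroup.localPi E c (2 + 2) J₂D v → ℂ,
      (∀ s₀ : ℂ, 0 < s₀.re → ∀ h, IsQRationalRegularAt (residueFieldCard (v.adicCompletion F)) s₀ (fun s => Fn s h)) ∧
      ∀ s : ℂ, 1 < s.re → ∀ h : UnitaryGroup.localPi E c (2 + 2) J₂D v,
        localIntertwining F E c v 2 hJ₂D νN (f s) h = aNorm F E c v 2 χv (νN.real {u | (u : UnitaryGroup.localPi E c (2 + 2) J₂D v) ∈ K₀}) s * Fn s h := by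
  rcases placesOver_cases' F E c v hcδ hδ with ⟨w, hw⟩ | ⟨w₁, w₂, hne, hw⟩
  · exact normalisedRegularity_of_forall_eq_allS0 F E c hcδ hδ hd v hT₂ hJ₂D D Dinv hDD hDD' Q hQm hQ νN χv hχ K₀ hK₀ hIw f hSieg hsm hflat w hw
  · exact normalisedRegularity_of_pair_allS0 F E c hcδ hδ hd v hT₂ hJ₂D D Dinv hDD hDD' Q hQm hQ νN χv hχ K₀ hK₀ hIw f hSieg hsm hflat w₁ w₂ hne hw

end EveryPlace

/-! ## §2 The CM datum `(L⁺, L, c, δ_L; T = gramR, J = hermD)`, `n = 2`, all `s₀` -/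

section CM

variable (L : Type) [Field L] [NumberField L] [IsCMField L] {N M : ℕ} (e : Fin N × Fin M ≃ Fin 2)
  (dV : Fin N → L) (hdV : ∀ i, IsCMField.complexConj L (dV i) = dV i) (hdV0 : ∀ i, dV i ≠ 0)
  (dW : Fin M → L) (hdW : ∀ i, IsCMField.complexConj L (dW i) = dW i) (hdW0 : ∀ i, dW i ≠ 0)
  (v : HeightOneSpectrum (𝓞 (GRConstruction.Fp L)))

set_option maxHeartbeats 400000 in -- as ★ B8-CM (measured 2026-09-04): instantiating §1 at the CM datum `(L⁺, L, gramR, hermD)` times out at `whnf` with 200 000; 400 000 passes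
include hdV0 hdW0 in
/-- **(A4′-R) AT THE CM DATUM, `n = 2`, ALL `s₀`** — for the doubled CM datum `H_v = U(𝕎 ⊕ −𝕎)(L⁺_v)`, `𝕎 = V ⊗ W` of rank `2` (`T = gramR L e dV dW`, `J = hermD`,
`δ = imagUnit L`): for every unitary `χ_v`, every compact open `K₀ ≤ H_v` with `H_v = P_Δ(L⁺_v)·K₀` and every `K₀`-flat family `f` of smooth Siegel sections of
`I_v(s, χ_v)` there is `Fn : ℂ → H_v → ℂ`, each `s ↦ Fn s h` rational in `q_v^{-s}` and regular at EVERY `s₀` with `0 < re s₀`, with `M_v(s)(f s) h = aNorm 2 χ_v (νN(N_Δ ∩ K₀)) s · Fn s h`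
on `1 < re s` — the all-`s₀` twin of ★ B8-CM `normalisedRegularity_cm`, binder for binder (§1 at the CM datum with the frame of ★ B8-CM `exists_adaptedFrame`;
★ `gramR_isSymm`, ★ `hermD_eq_map_gramD`, ★ `isUnit_det_gramR₀`); G6-fin's input «`Fn` has no pole on `0 < re s`». [cite: GelbartRogawski1991, §3.1 Prop. 3.1.1] [cite: KudlaSweet1997, §1] [cite: HarrisKudlaSweet1996, §6 (6.14)–(6.16)] [cite: Casselman1980, §3 Thm. 3.1] -/
theorem normalisedRegularity_cm_allS0
    [MeasurableSpace (unipDeltaLocal (GRConstruction.Fp L) L (IsCMField.complexConj L) v 2 (JD := GRConstruction.hermD L e dV hdV dW hdW))] [BorelSpace (unipDeltaLocal (GRConstruction.Fp L) L (IsCMField.complexConj L) v 2 (JD := GRConstruction.hermD L e dV hdV dW hdW))]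
    (νN : Measure (unipDeltaLocal (GRConstruction.Fp L) L (IsCMField.complexConj L) v 2 (JD := GRConstruction.hermD L e dV hdV dW hdW))) [νN.IsHaarMeasure]
    (χv : ∀ w : PlacesOver L v, (w.1.adicCompletion L)ˣ →* ℂˣ) :
    haveI : Algebra.IsQuadraticExtension (GRConstruction.Fp L) L := IsCMField.isQuadraticExtension L
    ∀ (_hχ : ∀ (w' : PlacesOver L v) (x : (w'.1.adicCompletion L)ˣ), ‖((χv w' x : ℂˣ) : ℂ)‖ = 1)
      (K₀ : Subgroup (UnitaryGroup.localPi L (IsCMField.complexConj L) (2 + 2) (GRConstruction.hermD L e dV hdV dW hdW) v))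
      (_hK₀ : IsCompact (K₀ : Set (UnitaryGroup.localPi L (IsCMField.complexConj L) (2 + 2) (GRConstruction.hermD L e dV hdV dW hdW) v)) ∧ IsOpen (K₀ : Set (UnitaryGroup.localPi L (IsCMField.complexConj L) (2 + 2) (GRConstruction.hermD L e dV hdV dW hdW) v)))
      (_hIw : ∀ g : UnitaryGroup.localPi L (IsCMField.complexConj L) (2 + 2) (GRConstruction.hermD L e dV hdV dW hdW) v,
        ∃ p, IsSiegelDelta (GRConstruction.Fp L) L (IsCMField.complexConj L) (UnitaryDualPair.complexConj_imagUnit L) (UnitaryDualPair.imagUnit_ne_zero L) (UnitaryDualPair.imagUnit_mul_self L)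
        v 2 (GRConstruction.gramR_isSymm L e dV hdV dW hdW) (GRConstruction.hermD_eq_map_gramD L e dV hdV dW hdW) p ∧ ∃ k ∈ K₀, g = p * k)
      (f : ℂ → UnitaryGroup.localPi L (IsCMField.complexConj L) (2 + 2) (GRConstruction.hermD L e dV hdV dW hdW) v → ℂ),
      (∀ s, IsLocalSiegelSection (GRConstruction.Fp L) L (IsCMField.complexConj L) (UnitaryDualPair.complexConj_imagUnit L) (UnitaryDualPair.imagUnit_ne_zero L) (UnitaryDualPair.imagUnit_mul_self L)
        v 2 (GRConstruction.gramR_isSymm L e dV hdV dW hdW) (GRConstruction.hermD_eq_map_gramD L e dV hdV dW hdW) χv s (f s)) →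
      (∀ s, IsSmooth (GRConstruction.Fp L) L (IsCMField.complexConj L) v 2 (f s)) →
      (∀ s s' : ℂ, ∀ k ∈ K₀, f s k = f s' k) →
      ∃ Fn : ℂ → UnitaryGroup.localPi L (IsCMField.complexConj L) (2 + 2) (GRConstruction.hermD L e dV hdV dW hdW) v → ℂ,
        (∀ s₀ : ℂ, 0 < s₀.re → ∀ h, IsQRationalRegularAt (residueFieldCard (v.adicCompletion (GRConstruction.Fp L))) s₀ (fun s => Fn s h)) ∧
        ∀ s : ℂ, 1 < s.re → ∀ h : UnitaryGroup.localPi L (IsCMField.complexConj L) (2 + 2) (GRConstruction.hermD L e dV hdV dW hdW) v,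
          localIntertwining (GRConstruction.Fp L) L (IsCMField.complexConj L) v 2 (GRConstruction.hermD_eq_map_gramD L e dV hdV dW hdW) νN (f s) h =
            aNorm (GRConstruction.Fp L) L (IsCMField.complexConj L) v 2 χv (νN.real {u | (u : UnitaryGroup.localPi L (IsCMField.complexConj L) (2 + 2) (GRConstruction.hermD L e dV hdV dW hdW) v) ∈ K₀}) s * Fn s h := by
  haveI : Algebra.IsQuadraticExtension (GRConstruction.Fp L) L := IsCMField.isQuadraticExtension L
  intro hχ K₀ hK₀ hIw f hSieg hsm hflat
  obtain ⟨D, Dinv, Q, hDD, hDD', hQm, hQ⟩ :=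
    exists_adaptedFrame (GRConstruction.Fp L) 2 (GRConstruction.gramR_isSymm L e dV hdV dW hdW) (GRConstruction.isUnit_det_gramR₀ L e dV hdV hdV0 dW hdW hdW0)
  exact normalisedRegularity_allS0 (GRConstruction.Fp L) L (IsCMField.complexConj L) (UnitaryDualPair.complexConj_imagUnit L) (UnitaryDualPair.imagUnit_ne_zero L)
    (UnitaryDualPair.imagUnit_mul_self L) v (GRConstruction.gramR_isSymm L e dV hdV dW hdW) (GRConstruction.hermD_eq_map_gramD L e dV hdV dW hdW)
    D Dinv hDD hDD' Q hQm hQ νN χv hχ K₀ hK₀ hIw f hSieg hsm hflat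

end CM

end Summit.HodgeConjecture.HodgeConjecture.Cruxes.HLiu418.K2LiuA7NormalisedRegularityCMAllS0

end
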